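import Mathlib.Geometry.Manifold.Instances.Sphere
import Mathlib.Geometry.Manifold.Diffeomorph
import Mathlib.Topology.Homotopy.Contractible
import Literature.Topology.FourManifolds.ConnectedSum
import Literature.Topology.FourManifolds.Cobordism
import HarnessLib

/-!
# Barrier (SmoothPoincare4): one stabilisation is not enough for contractible 4-manifolds (Kang)

Barrier catalogue `Literature/Barriers/SmoothPoincare4/` (D-0021), entry for the technique class
**"dissolve exotica with ONE `S² × S²` summand, uniformly"** — arguments that would prove Wall's
stabilisation theorem with `k = 1` for every homeomorphic pair, in particular at the level of corks
/ contractible pieces (route `Stabilisation` asks `k = 1` for homotopy 4-spheres, its conjunct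
S1: `Σ # (S² × S²) ≅ S² × S²`; by the cork theorem an exotic `Σ` would be a cork twist of `S⁴`, so
a cork-level one-stabilisation lemma would give S1). Kang exhibits a cork, and Akbulut–Ruberman-type
absolutely exotic contractible pairs, that survive one stabilisation; the closed simply connected
case is open.

## What is printed (Kang, arXiv:2210.07510v3)

* §1: "It is a widely known fact that any pair of homeomorphic simply-connected 4-manifolds are
  stably diffeomorphic ... [Wall 1964]. It is thus a natural question to ask, given such a pair,
  how many copies of `S² × S²` are necessary to make them diffeomorphic? There are lots of
  families of homeomorphic simply connected 4-manifolds, including simply-connected elliptic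
  surfaces, which become diffeomorphic after one stabilization. However, there has been no known
  example where one stabilization is not enough to obtain a diffeomorphism."; "given any cork
  `(Y, W, f)`, there always exists an integer `n > 0` such that `f` extends smoothly to a
  self-diffeomorphism of `W ♯ n(S² × S²)` [Gompf 1984]".
* "Theorem 1.1. There exists a cork `(Y, W, f)` such that `f` does not extend to a
  self-diffeomorphism of `W ♯ (S² × S²)`." "Corollary 1.2. There exist homeomorphic smooth
  contractible 4-manifolds `W₁`, `W₂`, with diffeomorphic boundaries, such that `W₁ ♯ (S² × S²)`
  and `W₂ ♯ (S² × S²)` are not diffeomorphic." (via the arguments of Akbulut–Ruberman 2016).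
* "Question 1. Can we perform a cork twist using the cork we construct in the proof of Theorem
  1.1 to find an exotic closed simply-connected 4-manifold which remains exotic after one
  stabilization by `S² × S²`?" — "We were unable to prove it, so we leave it as a question."

## What is printed around it (barrier audit 2026-08-16: evasions and status)

* Hayden–Kang–Mukherjee (arXiv:2304.01504), Lemma 3.1: "Let `D` and `D′` be slice disks in `B⁴`
  bounded by a knot `K ⊂ S³`. (a) If `k` is even, then `B⁴_{1/k}(D) ♯ (S² × S²) ≅
  B⁴_{1/k}(D′) ♯ (S² × S²)` rel boundary. (b) If `k` is odd, then `B⁴_{1/k}(D) ♯ (S² ×~ S²) ≅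
  B⁴_{1/k}(D′) ♯ (S² ×~ S²)` rel boundary." (proof: the spheres `S = D ∪ core`, `S′ = D′ ∪ core`
  in `Z = X₀(K) ∪ (−k)`-framed meridian handle "have simply-connected complements ... and ...
  represent a characteristic homology class if and only if `k` is odd. By [AKM⁺19], `S` and `S′`
  are isotopic in `Z` (rel `∂Z`) after one stabilization with either `S² × S²` if `k` is even or
  `S² ×~ S²` if `k` is odd"); §3.1 and Prop. 3.3, about the pair `W`, `W′` "constructed by the
  second author in [Kan22]" from "(+1)-surgeries along disks `D, D′ ⊂ B⁴` with the same boundary":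
  "`W ♯ (S² ×~ S²)` and `W′ ♯ (S² ×~ S²)` are diffeomorphic rel boundary."
* Guth–Kang (arXiv:2404.06618), Thm. 1.8: "Given any odd integers `n, m ≥ 3` ...
  `Y_{m,n} = S³₊₁(4K_{m,n} ♯ −4K_{m,n})` bounds a pair of smooth contractible 4-manifolds which
  are homeomorphic but not diffeomorphic even after one stabilization, i.e. connected summing
  with one copy of `S² × S²`."; Kang's v3, §2.2: "We will use the following three theorems from
  [GK24]" (Thms. 2.4–2.6), and Acknowledgement: "an anonymous referee for pointing out gaps in
  the previous version of the paper."
* Powell (J. Lond. Math. Soc. 113 (2026)), §1.2: "For stably diffeomorphic but not diffeomorphic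
  4-manifolds, how large must `k` be ...? It remains a famous open question whether there are
  h-cobordant scosc 4-manifolds for which one must take `k > 1`. For many examples, it has been
  shown that one `S² × S²` summand suffices [Auckly 2003, Baykur 2018, Choi–Park–Yun 2019].
  Recently, Sungkyung Kang announced examples of pairs of compact, contractible 4-manifolds
  (which have nonempty boundary) where `k = 2` is needed."
* Huang (arXiv:2411.00517), Thm. 1.0.1: an oriented 5-dimensional `s`-cobordism between closed
  4-manifolds carrying a Morse function with only `k` pairs of critical points of index 2, 3
  "becomes a product cobordism after `k` times of stabilizations"; §1: for closed manifolds "we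
  still don't know if one time is enough".
* Hayden (arXiv:2302.10127), Example 2.1: "the positron cork becomes diffeomorphic (rel
  boundary) to its twist after one stabilization. If exotic 4-manifolds `X₀` and `X₁` are
  related by twisting along two disjoint copies of the positron cork ... because the corks are
  disjoint, we may use a single `S² × S²` summand for both corks, implying
  `X₀ ♯ S² × S² ≅ X₁ ♯ S² × S²`."

## How it is rendered here (relative to the tree's notions, D-0014)

Compact contractible smooth 4-manifolds with boundary as in `Corks.lean` (model `𝓡∂ 4`,
`BoundaryData`); the (interior) connected sum with `S² × S²` through the tree's model-generic
relational `Literature.IsConnectedSum (𝓡∂ 4) (𝓡∂ 4) ((𝓡 2).prod (𝓡 2)) W (S² × S²) P` (open 4-discs in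
`W` and in `S² × S²`, Kervaire–Milnor gluing), `S² × S²` being Mathlib's product of unit spheres.

* `OneStabilisationSufficesContractible` — the master statement (compact contractible smooth
  4-manifolds that are homeomorphic and have diffeomorphic boundaries become diffeomorphic after
  one connected sum with `S² × S²`), explicit `Prop`.
* `kang2022_corollary12` — named fact (Cor. 1.2), in the `∃`-form over the relational sums.
* `OneStabilisationBarrier := ¬ OneStabilisationSufficesContractible` — PROVED from the fact
  (`oneStabilisationBarrier_of_kang`).

## References

[Kang2022OneStabilization] [AkbulutRuberman2016] [WallJLMS1964] [KervaireMilnorAnnals1963]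
[HaydenKangMukherjee2023] [GuthKang2024] [AucklyEtAl2019] [Gabai2020] [Powell2026] [Huang2024]
[Hayden2023] [KirbyCorks1996]
-/

noncomputable section

open scoped Manifold ContDiff

namespace Literature.Barriers.SmoothPoincare4

/-- Local notation: `𝕊 n` is the unit sphere in `EuclideanSpace ℝ (Fin (n + 1))`, the standard
`n`-sphere with its Mathlib manifold structure. -/
local notation "𝕊 " n:arg => (Metric.sphere (0 : EuclideanSpace ℝ (Fin (n + 1))) 1)

/-! ### The technique's master statement -/

/-- **One stabilisation suffices for compact contractible 4-manifolds (master statement).**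
Whenever `W₁`, `W₂` are compact (Hausdorff, second countable) contractible smooth 4-manifolds with
boundary data `b₁`, `b₂`, with diffeomorphic boundaries (`∂W₁ ≅ ∂W₂`) AND homeomorphic (both
hypotheses are put in — the weakest form of the technique's conclusion, so that its negation is
the strongest), and `P₁`, `P₂` (smooth 4-manifolds with boundary) are connected sums of `W₁`,
resp. `W₂`, with `S² × S²` (tree `Literature.Topology.FourManifolds.IsConnectedSum`, interior discs), then `P₁ ≅ P₂`. Some
number of stabilisations always suffices (Gompf 1984, as recalled by Kang, §1); ONE does not
(`oneStabilisationBarrier_of_kang`). [cite: Kang2022OneStabilization, §1 and Cor. 1.2] -/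
def OneStabilisationSufficesContractible : Prop :=
  ∀ (W₁ W₂ : Type) [TopologicalSpace W₁] [T2Space W₁] [SecondCountableTopology W₁]
    [ChartedSpace (EuclideanHalfSpace 4) W₁] [IsManifold (𝓡∂ 4) ∞ W₁] [CompactSpace W₁]
    [ContractibleSpace W₁]
    [TopologicalSpace W₂] [T2Space W₂] [SecondCountableTopology W₂]
    [ChartedSpace (EuclideanHalfSpace 4) W₂] [IsManifold (𝓡∂ 4) ∞ W₂] [CompactSpace W₂]
    [ContractibleSpace W₂] (b₁ : Literature.Topology.FourManifolds.BoundaryData (𝓡∂ 4) W₁ (𝓡 3)) (b₂ : Literature.Topology.FourManifolds.BoundaryData (𝓡∂ 4) W₂ (𝓡 3)),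
    Nonempty (b₁.carrier ≃ₘ⟮𝓡 3, 𝓡 3⟯ b₂.carrier) → Nonempty (W₁ ≃ₜ W₂) →
    ∀ (P₁ P₂ : Type) [TopologicalSpace P₁] [T2Space P₁] [SecondCountableTopology P₁]
      [ChartedSpace (EuclideanHalfSpace 4) P₁] [IsManifold (𝓡∂ 4) ∞ P₁]
      [TopologicalSpace P₂] [T2Space P₂] [SecondCountableTopology P₂]
      [ChartedSpace (EuclideanHalfSpace 4) P₂] [IsManifold (𝓡∂ 4) ∞ P₂],
      Literature.Topology.FourManifolds.IsConnectedSum (𝓡∂ 4) (𝓡∂ 4) ((𝓡 2).prod (𝓡 2)) W₁ ((𝕊 2) × (𝕊 2)) P₁ →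
      Literature.Topology.FourManifolds.IsConnectedSum (𝓡∂ 4) (𝓡∂ 4) ((𝓡 2).prod (𝓡 2)) W₂ ((𝕊 2) × (𝕊 2)) P₂ →
        Nonempty (P₁ ≃ₘ⟮𝓡∂ 4, 𝓡∂ 4⟯ P₂)

/-! ### Kang's corollary -/

/-- **Kang, Cor. 1.2 (named fact).** There are homeomorphic compact contractible smooth
4-manifolds `W₁`, `W₂` with diffeomorphic boundaries, and connected sums `P₁` of `W₁` with
`S² × S²` and `P₂` of `W₂` with `S² × S²`, such that `P₁` and `P₂` are not diffeomorphic ("There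
exist homeomorphic smooth contractible 4-manifolds `W₁`, `W₂`, with diffeomorphic boundaries,
such that `W₁ ♯ (S² × S²)` and `W₂ ♯ (S² × S²)` are not diffeomorphic"; from Thm. 1.1, a cork
`(Y, W, f)` with `f` not extending over `W ♯ (S² × S²)`, detected by involutive Heegaard Floer
homology, plus Akbulut–Ruberman's construction). Rendered in `∃`-form over the tree's relational
connected sum (for some choice of the sums), which the printed well-defined `♯` implies. Users take
`(h : kang2022_corollary12)`. [cite: Kang2022OneStabilization, Cor. 1.2 and Thm. 1.1] -/
def kang2022_corollary12 : Prop :=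
  ∃ (W₁ W₂ : Type) (_ : TopologicalSpace W₁) (_ : T2Space W₁) (_ : SecondCountableTopology W₁)
    (_ : ChartedSpace (EuclideanHalfSpace 4) W₁) (_ : IsManifold (𝓡∂ 4) ∞ W₁) (_ : CompactSpace W₁)
    (_ : ContractibleSpace W₁)
    (_ : TopologicalSpace W₂) (_ : T2Space W₂) (_ : SecondCountableTopology W₂)
    (_ : ChartedSpace (EuclideanHalfSpace 4) W₂) (_ : IsManifold (𝓡∂ 4) ∞ W₂) (_ : CompactSpace W₂)
    (_ : ContractibleSpace W₂)
    (b₁ : Literature.Topology.FourManifolds.BoundaryData (𝓡∂ 4) W₁ (𝓡 3)) (b₂ : Literature.Topology.FourManifolds.BoundaryData (𝓡∂ 4) W₂ (𝓡 3))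
    (P₁ P₂ : Type) (_ : TopologicalSpace P₁) (_ : T2Space P₁) (_ : SecondCountableTopology P₁)
    (_ : ChartedSpace (EuclideanHalfSpace 4) P₁) (_ : IsManifold (𝓡∂ 4) ∞ P₁)
    (_ : TopologicalSpace P₂) (_ : T2Space P₂) (_ : SecondCountableTopology P₂)
    (_ : ChartedSpace (EuclideanHalfSpace 4) P₂) (_ : IsManifold (𝓡∂ 4) ∞ P₂),
    Nonempty (b₁.carrier ≃ₘ⟮𝓡 3, 𝓡 3⟯ b₂.carrier) ∧ Nonempty (W₁ ≃ₜ W₂) ∧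
      Literature.Topology.FourManifolds.IsConnectedSum (𝓡∂ 4) (𝓡∂ 4) ((𝓡 2).prod (𝓡 2)) W₁ ((𝕊 2) × (𝕊 2)) P₁ ∧
      Literature.Topology.FourManifolds.IsConnectedSum (𝓡∂ 4) (𝓡∂ 4) ((𝓡 2).prod (𝓡 2)) W₂ ((𝕊 2) × (𝕊 2)) P₂ ∧
      IsEmpty (P₁ ≃ₘ⟮𝓡∂ 4, 𝓡∂ 4⟯ P₂)

/-! ### The barrier -/

/-- **Barrier (named statement): one stabilisation does not suffice for compact contractible
4-manifolds** (`¬ OneStabilisationSufficesContractible`). PROVED below from Kang's Cor. 1.2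
(`oneStabilisationBarrier_of_kang`).

BARRIER (D-0021), one line per key:
* technique_class: uniform one-stabilisation arguments — proving that a single `S² × S²` summand dissolves the difference between homeomorphic (h-cobordant) smooth 4-manifolds, at the level of corks / compact contractible pieces (where SOME number of summands always suffices) [cite: Kang2022OneStabilization, §1 (Gompf 1984) and Thm. 1.1]; formally `OneStabilisationSufficesContractible`.
* blocks: the natural strengthening of conjunct S1 of route `Stabilisation` ("`Σ # (S² × S²) ≅ S² × S²` for every homotopy 4-sphere", Wall's theorem [cite: WallJLMS1964, Thm. 3] with `k = 1`) from homotopy 4-spheres to all homeomorphic compact contractible 4-manifolds, and any proof of S1 through a cork-level lemma "every cork is undone by one stabilisation" [cite: Kang2022OneStabilization, Thm. 1.1 and Cor. 1.2].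
* because: a cork `(Y, W, f)` built so that an involutive Heegaard Floer obstruction (bordered/knot Floer computation) survives the connected sum with `S² × S²` shows `f` does not extend over `W ♯ (S² × S²)` [cite: Kang2022OneStabilization, Thm. 1.1, §§3-5]; Akbulut–Ruberman's passage from relative to absolute exotica then yields homeomorphic contractible `W₁`, `W₂` with `W₁ ♯ (S² × S²) ≇ W₂ ♯ (S² × S²)` [cite: Kang2022OneStabilization, Cor. 1.2] [cite: AkbulutRuberman2016, Thm. A]; the bordered naturality and invariant-splitting inputs of v3 are imported from Guth–Kang, who generalise the phenomenon to infinitely many homology spheres `Y_{m,n} = S³₊₁(4K_{m,n} ♯ −4K_{m,n})`, each bounding a pair of contractible 4-manifolds "homeomorphic but not diffeomorphic even after one stabilization" [cite: GuthKang2024, Thm. 1.8 and §1] [cite: Kang2022OneStabilization, §2.2 (Thms. 2.4-2.6)].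
* evasions_known: (1) the CLOSED simply connected case is open — "there has been no known example where one stabilization is not enough" and Question 1 asks for a closed example from this cork [cite: Kang2022OneStabilization, §1 and Question 1]; still open in 2026: "It remains a famous open question whether there are h-cobordant scosc 4-manifolds for which one must take k > 1" [cite: Powell2026, §1.2] [cite: Huang2024, §1]; (2) the barrier is specific to the UNTWISTED summand and to CHARACTERISTIC exchange spheres: for slice discs `D, D′ ⊂ B⁴` with the same boundary, the surgeries `B⁴_{1/k}(D)`, `B⁴_{1/k}(D′)` become diffeomorphic REL BOUNDARY after one `S² × S²` when `k` is even and after one twisted `S² ×~ S² = ℂP² ♯ ℂP²bar` when `k` is odd (Auckly–Kim–Melvin–Ruberman–Schwartz one-is-enough isotopy, via Gabai's light bulb theorem, for the two square-0 spheres `D ∪ core`, `D′ ∪ core`, which are characteristic iff `k` is odd) [cite: HaydenKangMukherjee2023, Lemma 3.1 and Remark 1.2(a)] [cite: AucklyEtAl2019] [cite: Gabai2020]; in particular Kang's own pair (`k = +1`) — and likewise every `(+1)`-surgery pair of [cite: GuthKang2024, Thm. 1.8] — is diffeomorphic rel boundary after ONE twisted stabilisation [cite: HaydenKangMukherjee2023,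 Prop. 3.3]; so neither "one twisted / `ℂP²`-type stabilisation suffices at cork level" nor "one `S² × S²` suffices for corks exchanging ORDINARY (non-characteristic) spheres with simply connected complements" is touched; (3) many families (e.g. simply connected elliptic surfaces) do become diffeomorphic after one stabilisation [cite: Kang2022OneStabilization, §1] [cite: Powell2026, §1.2]; simple corks such as the positron cork become diffeomorphic rel boundary to their twist after one stabilisation, and DISJOINT copies of such corks share a single summand [cite: Hayden2023, Example 2.1]; (4) an `h`- or `s`-cobordism carrying a Morse function with `k` pairs of index-2/3 critical points becomes a product after `k` stabilisations, so S1 follows from an `h`-cobordism `S⁴ ∼ Σ` with ONE such pair [cite: Huang2024, Thm. 1.0.1] [cite: WallJLMS1964, Thm. 3]; (5) two or more stabilisations are beyond the method (`Q² = 0`) [cite: Kang2022OneStabilization, Question 2].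
* scope_caveats: (a) the fact concerns compact contractible manifolds WITH BOUNDARY (homology-sphere boundaries), not homotopy 4-balls or homotopy 4-spheres; nothing is claimed about S1 itself [cite: Kang2022OneStabilization, Cor. 1.2 and Question 1]; (b) `kang2022_corollary12` is rendered in `∃`-form over the tree's relational, orientation-free `Literature.Topology.FourManifolds.IsConnectedSum` (for SOME connected sums `P₁`, `P₂`), which the printed statement about the well-defined `W ♯ (S² × S²)` implies; (c) Thm. 1.1 (the relative, cork-level statement) is not rendered in THIS file, since "`f` extends over `W ♯ (S² × S²)`" needs a boundary datum of the sum — it is the named fact `kang2022_theorem11` of the sibling `OneStabilisationContractibleCorkProofs.lean` (notion `ExtendsOverStabilisation`); (d) a cork in the source's sense carries an ARBITRARY boundary diffeomorphism `f` ("a diffeomorphism which does not extend smoothly to `W`"); that `f` is an involution is neither claimed nor used — Kang's `F` is induced by a summand swap composed with a "half Dehn twist", and no order-two cork surviving one stabilisation is printed [cite: Kang2022OneStabilization, §3 (definition p. 11, the cork p. 12) and §1]; the `blocks:` clause nevertheless reaches the INVOLUTIVE corks of the cork theorem (tree `Literature.Topology.FourManifolds.IsCork`) non-constructively: Kang's rel-boundary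 pair `B⁴₊₁(D_{K,id})`, `B⁴₊₁(D_{K,f})`, `Θ₄ = 0` and the cork decomposition of the resulting rel-boundary h-cobordism with Matveyev's involution [cite: KirbyCorks1996, Theorem, Addendum (D) and Corollary] [cite: AkbulutRuberman2016, §1] give an involutive cork inside `B⁴₊₁(D_{K,id})` that no single `S² × S²` undoes (assembly, and the folklore status of the bounded decomposition theorem, in `OneStabilisationContractibleProofs.lean`, § "Reach over involutive corks"); the residual sub-class "involutive corks embedded in `S⁴` as corks of `(S⁴, Σ)`" already yields S1 [cite: KirbyCorks1996, Corollary] (audit 2026-08-16); (e) only the untwisted `S² × S²` summand is covered — see evasions (2).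
* status: established (theorem: `oneStabilisationBarrier_of_kang` from the named fact) [cite: Kang2022OneStabilization, Cor. 1.2]; provenance of the fact: arXiv preprint, v3 (2024) revised after "an anonymous referee ... pointing out gaps in the previous version" [cite: Kang2022OneStabilization, Acknowledgement], with inputs from the preprint [cite: GuthKang2024, §1]; listed as a preprint by zbMATH and described as "announced" in [cite: Powell2026, §1.2] (audit 2026-08-16).

[cite: Kang2022OneStabilization, Thm. 1.1, Cor. 1.2, Question 1] -/
def OneStabilisationBarrier : Prop :=
  ¬ OneStabilisationSufficesContractible

/-- **`OneStabilisationBarrier` follows from Kang's Cor. 1.2** (hypothesis `hK`, D-0014).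
[cite: Kang2022OneStabilization, Cor. 1.2] -/
theorem oneStabilisationBarrier_of_kang (hK : kang2022_corollary12) : OneStabilisationBarrier := by
  intro h
  obtain ⟨W₁, W₂, _, _, _, _, _, _, _, _, _, _, _, _, _, _, b₁, b₂, P₁, P₂, _, _, _, _, _, _, _, _, _, _,
    hB, hW, hP₁, hP₂, hE⟩ := hK
  obtain ⟨e⟩ := h W₁ W₂ b₁ b₂ hB hW P₁ P₂ hP₁ hP₂
  exact hE.false e

end Literature.Barriers.SmoothPoincare4

end
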